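import Mathlib.Analysis.SpecialFunctions.Gamma.Beta
import Mathlib.Analysis.SpecialFunctions.Pow.Real
import Mathlib.Analysis.SpecialFunctions.Trigonometric.Basic
import Mathlib.Tactic.LinearCombination
import Literature.Analysis.SpecialFunctions.GammaMultiplication
import Literature.Analysis.SpecialFunctions.EquianharmonicConstant
import HarnessLib

/-!
# Gauss triplication and the radical period constants of the degree-9 Fermat surface (proved values)

Topic: `Literature/Analysis/SpecialFunctions`. For a Hodge character `a = (a₀,…,a₃)` of the Fermat
surface `X^2_d : x₀^d + ⋯ + x₃^d = 0`, Deligne's normalised period constant is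
`Γ̃(a) = (2πi)^{-2} ∏ᵢ Γ(aᵢ/d)` (Deligne, LNM 900 (1982), I §7, (7.5), Prop. 7.13, Thm. 7.15: `Γ̃(a)` is
algebraic, lies in an abelian extension of `ℚ(ζ_d)`, and its Galois conjugates are governed by the
conjugate characters). For `d = 9` exactly one `(ℤ/9)^×`-orbit of Hodge characters has
`Γ̃ ∉ ℚ(ζ₉)`: the orbit `{(1,4,6,7), (2,3,5,8)}`, whose values carry the radical `3^{1/3}`. Legendre
duplication does not reach it; Gauss TRIPLICATION does. This file

* derives the real triplication formula `Γ(x)Γ(x+1/3)Γ(x+2/3)·3^{3x} = 2π√3·Γ(3x)` (`x > 0`) from the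
  tree's general multiplication theorem `GaussMultiplication.real_formula` (Andrews–Askey–Roy,
  Thm. 1.5.2; proved in `GammaMultiplication.lean`), reuses the landed reflection value
  `Gamma_one_third_mul_Gamma_two_thirds` (`EquianharmonicConstant.lean`), and
* PROVES the two orbit values

  `Γ(1/9)Γ(4/9)Γ(6/9)Γ(7/9) = 4π² / 3^{1/3}`,   `Γ(2/9)Γ(3/9)Γ(5/9)Γ(8/9) = 4π² / 3^{2/3}`,

  i.e. `Γ̃(1,4,6,7) = −3^{−1/3}` and `Γ̃(2,3,5,8) = −3^{−2/3}` (since `(2πi)² = −4π²`), together with the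
  sign statement in `ℂ`.

These are the kernel certificates of the `d = 9` entries of the cell pub-hlocus absolute-Hodge
table (HOME/ABSHODGE.md, engine A `X_2_9.json`, engine B, referee audit R10–R11, where this orbit was
the one left open: "needs Gauss triplication"). Galois check: under `τ : 3^{1/3} ↦ ζ₃3^{1/3}` one
gets `λ_a(τ) = Γ̃(a)/τΓ̃(a) = ζ₃^{-1} ∈ ℚ(ζ₉)` and `λ_{2a}(τ) = ζ₃^{-2} = τ₂(λ_a(τ))`-compatible values, an
instance of Deligne's Thm. 7.15(c) (recorded in the cell's tables; not re-proved here). The identities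
are classical `Γ`-calculus, proved, not cited; no named fact is introduced.

HONEST FRAMING (cell pub-hlocus): certified instances and evidence bearing on the general Hodge
conjecture; no claim.

## Sources

* P. Deligne, *Hodge cycles on abelian varieties* (notes by J. Milne), LNM 900, Springer 1982, I §7,
  Prop. 7.13, Thm. 7.15.
* G. E. Andrews, R. Askey, R. Roy, *Special Functions*, CUP 1999, Thm. 1.5.2 (Gauss multiplication).
* NIST DLMF §5.5: 5.5.3 (reflection), 5.5.6 (Gauss multiplication). https://dlmf.nist.gov/5.5
* T. Shioda, *On the Picard number of a Fermat surface*, J. Fac. Sci. Univ. Tokyo 28 (1982) — the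
  Hodge characters of `X^2_d`.
-/

noncomputable section

open scoped Real

namespace Literature.Analysis.SpecialFunctions

/-- Gauss triplication, real form: for `x > 0`,
`Γ(x)·Γ(x + 1/3)·Γ(x + 2/3)·3^{3x} = Γ(3x)·√3·(2π)` — the case `n = 3` of
`GaussMultiplication.real_formula`. [cite: AndrewsAskeyRoy1999, Thm 1.5.2] [cite: DLMF, 5.5.6] -/
theorem Real_Gamma_triplication {x : ℝ} (hx : 0 < x) :
    Real.Gamma x * Real.Gamma (x + 1 / 3) * Real.Gamma (x + 2 / 3) * (3 : ℝ) ^ (3 * x) =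
      Real.Gamma (3 * x) * Real.sqrt 3 * (2 * π) := by
  have h := GaussMultiplication.real_formula (n := 3) (by norm_num) hx
  simp only [GaussMultiplication.prodGamma, Finset.prod_range_succ, Finset.prod_range_zero, one_mul,
    Nat.cast_zero, Nat.cast_one, Nat.cast_ofNat, zero_div, add_zero] at h
  norm_num at h
  linear_combination h

/-- The orbit member `(1,4,6,7)` of `X^2_9`:  `Γ(1/9)Γ(4/9)Γ(6/9)Γ(7/9) = 4π²/3^{1/3}`
(triplication at `x = 1/9` and reflection at `1/3`).
[cite: Deligne1982HodgeCycles, I Thm. 7.15] [cite: AndrewsAskeyRoy1999, Thm 1.5.2] -/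
theorem Real_Gamma_prod_fermat9_1_4_6_7 :
    Real.Gamma (1 / 9) * Real.Gamma (4 / 9) * Real.Gamma (6 / 9) * Real.Gamma (7 / 9) =
      4 * π ^ 2 / (3 : ℝ) ^ ((1 : ℝ) / 3) := by
  rw [show (6 / 9 : ℝ) = 2 / 3 by norm_num]
  have h31 := Real_Gamma_triplication (show (0 : ℝ) < 1 / 9 by norm_num)
  norm_num at h31
  have ht : (3 : ℝ) ^ ((1 : ℝ) / 3) ≠ 0 := (Real.rpow_pos_of_pos (by norm_num) _).ne'
  have hs : Real.sqrt 3 ≠ 0 := (Real.sqrt_pos.mpr (by norm_num : (0:ℝ) < 3)).ne'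
  set G1 := Real.Gamma (1 / 9)
  set G3 := Real.Gamma (1 / 3)
  set G4 := Real.Gamma (4 / 9)
  set G6 := Real.Gamma (2 / 3)
  set G7 := Real.Gamma (7 / 9)
  set t := (3 : ℝ) ^ ((1 : ℝ) / 3)
  rw [eq_div_iff ht]
  have key : G1 * G4 * G6 * G7 * t = (G1 * G4 * G7 * t) * G6 := by ring
  rw [key, h31]
  have hR : G3 * G6 = 2 * π / Real.sqrt 3 := Gamma_one_third_mul_Gamma_two_thirds
  calc G3 * Real.sqrt 3 * (2 * π) * G6 = (G3 * G6) * Real.sqrt 3 * (2 * π) := by ring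
    _ = 2 * π / Real.sqrt 3 * Real.sqrt 3 * (2 * π) := by rw [hR]
    _ = 4 * π ^ 2 := by field_simp; ring

/-- The orbit member `(2,3,5,8)` of `X^2_9`:  `Γ(2/9)Γ(3/9)Γ(5/9)Γ(8/9) = 4π²/3^{2/3}`
(triplication at `x = 2/9` and reflection at `1/3`).
[cite: Deligne1982HodgeCycles, I Thm. 7.15] [cite: AndrewsAskeyRoy1999, Thm 1.5.2] -/
theorem Real_Gamma_prod_fermat9_2_3_5_8 :
    Real.Gamma (2 / 9) * Real.Gamma (3 / 9) * Real.Gamma (5 / 9) * Real.Gamma (8 / 9) =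
      4 * π ^ 2 / (3 : ℝ) ^ ((2 : ℝ) / 3) := by
  rw [show (3 / 9 : ℝ) = 1 / 3 by norm_num]
  have h32 := Real_Gamma_triplication (show (0 : ℝ) < 2 / 9 by norm_num)
  norm_num at h32
  have ht : (3 : ℝ) ^ ((2 : ℝ) / 3) ≠ 0 := (Real.rpow_pos_of_pos (by norm_num) _).ne'
  have hs : Real.sqrt 3 ≠ 0 := (Real.sqrt_pos.mpr (by norm_num : (0:ℝ) < 3)).ne'
  set G2 := Real.Gamma (2 / 9)
  set G3 := Real.Gamma (1 / 3)
  set G5 := Real.Gamma (5 / 9)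
  set G6 := Real.Gamma (2 / 3)
  set G8 := Real.Gamma (8 / 9)
  set t := (3 : ℝ) ^ ((2 : ℝ) / 3)
  rw [eq_div_iff ht]
  have key : G2 * G3 * G5 * G8 * t = (G2 * G5 * G8 * t) * G3 := by ring
  rw [key, h32]
  have hR : G3 * G6 = 2 * π / Real.sqrt 3 := Gamma_one_third_mul_Gamma_two_thirds
  calc G6 * Real.sqrt 3 * (2 * π) * G3 = (G3 * G6) * Real.sqrt 3 * (2 * π) := by ring
    _ = 2 * π / Real.sqrt 3 * Real.sqrt 3 * (2 * π) := by rw [hR]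
    _ = 4 * π ^ 2 := by field_simp; ring

/-- Table values: `Γ̃(1,4,6,7)·(−1) = P₁/(4π²) = 3^{−1/3}` and `P₂/(4π²) = 3^{−2/3}`; the second is the square
of the first (the orbit's Kummer structure: `L = ℚ(ζ₉, 3^{1/3})`).
[cite: Deligne1982HodgeCycles, I Thm. 7.15] -/
theorem gammaTilde_fermat9_radical_orbit :
    Real.Gamma (1 / 9) * Real.Gamma (4 / 9) * Real.Gamma (6 / 9) * Real.Gamma (7 / 9) / (4 * π ^ 2) =
      (3 : ℝ) ^ (-(1 : ℝ) / 3) ∧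
    Real.Gamma (2 / 9) * Real.Gamma (3 / 9) * Real.Gamma (5 / 9) * Real.Gamma (8 / 9) / (4 * π ^ 2) =
      (3 : ℝ) ^ (-(2 : ℝ) / 3) ∧
    (3 : ℝ) ^ (-(2 : ℝ) / 3) = ((3 : ℝ) ^ (-(1 : ℝ) / 3)) ^ 2 := by
  have hpi : (4 : ℝ) * π ^ 2 ≠ 0 := by positivity
  refine ⟨?_, ?_, ?_⟩
  · rw [Real_Gamma_prod_fermat9_1_4_6_7, show (-(1 : ℝ) / 3) = -((1 : ℝ) / 3) by ring,
      Real.rpow_neg (by norm_num : (0 : ℝ) ≤ 3)]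
    field_simp
  · rw [Real_Gamma_prod_fermat9_2_3_5_8, show (-(2 : ℝ) / 3) = -((2 : ℝ) / 3) by ring,
      Real.rpow_neg (by norm_num : (0 : ℝ) ≤ 3)]
    field_simp
  · rw [← Real.rpow_natCast, ← Real.rpow_mul (by norm_num : (0 : ℝ) ≤ 3)]
    norm_num

/-- The signs: in `ℂ`, `Γ̃ = P/(2πi)² = −P/(4π²)` for both members, with `P > 0`; hence
`Γ̃(1,4,6,7) = −3^{−1/3}` and `Γ̃(2,3,5,8) = −3^{−2/3}` are NEGATIVE real algebraic numbers.
[cite: Deligne1982HodgeCycles, I Thm. 7.15] -/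
theorem Complex_gammaTilde_fermat9_radical_orbit :
    ((Real.Gamma (1 / 9) * Real.Gamma (4 / 9) * Real.Gamma (6 / 9) * Real.Gamma (7 / 9) : ℝ) : ℂ) /
        (2 * π * Complex.I) ^ 2 = -(((3 : ℝ) ^ (-(1 : ℝ) / 3) : ℝ) : ℂ) ∧
    ((Real.Gamma (2 / 9) * Real.Gamma (3 / 9) * Real.Gamma (5 / 9) * Real.Gamma (8 / 9) : ℝ) : ℂ) /
        (2 * π * Complex.I) ^ 2 = -(((3 : ℝ) ^ (-(2 : ℝ) / 3) : ℝ) : ℂ) := by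
  obtain ⟨h1, h2, -⟩ := gammaTilde_fermat9_radical_orbit
  have hden : (2 * (π : ℂ) * Complex.I) ^ 2 = -(4 * (π : ℂ) ^ 2) := by
    linear_combination (4 * (π : ℂ) ^ 2) * Complex.I_sq
  have hpi : (π : ℂ) ≠ 0 := Complex.ofReal_ne_zero.mpr Real.pi_pos.ne'
  refine ⟨?_, ?_⟩
  · rw [hden, ← h1]
    push_cast
    field_simp
  · rw [hden, ← h2]
    push_cast
    field_simp

end Literature.Analysis.SpecialFunctions
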